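import Summits.MatrixMultiplication.MatrixMultiplication.Theorems.AsymptoticRankCWBPerm3Form
import Summits.MatrixMultiplication.MatrixMultiplication.Theorems.AsymptoticRankCWGlueDet3Omega

/-!
# `BThesis` through the skew sibling: split glue, necessity, and the circle of implications
(route `MatrixMultiplication/AsymptoticRankCW`; crux `BThesis` = stmt-MatrixMultiplication-0588,
line `skew_anchor` of `Cruxes/BThesis/Lines/`; pieces `BDet3AsymptoticRank` = stmt-0591 and
`BSkewDominatesCw` = stmt-18009)

Notation. `T_cw,2 = cwTensor ℂ 2` (rfl-equal to the inline tensor of `BThesis`/`BSkewDominatesCw`);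
`ε` = the Levi-Civita tensor on `Fin 3` written inline exactly as in `BDet3AsymptoticRank`
(`ε(a,a+1,a+2) = 1`, `ε(a,a+2,a+1) = -1`; `ε ≅ T_skewcw,2`, `ε ⊠ ε ≅ det₃`,
Conner–Gesmundo–Landsberg–Ventura 2022, Lemma 2.4 and p. 7); `R̃ = asymptoticRank`.

Content (all sorry-free, standard axioms):
* `three_le_asymptoticRank_leviCivita` — `3 = ζ⁽¹⁾(ε) ≤ R̃(ε)` (the three `x`-slices of `ε` are
  linearly independent; flattening rank bounds asymptotic rank from below);
* `asymptoticRank_leviCivita_le_three_of_det3` — `R̃(ε ⊠ ε) = 9 ⇒ R̃(ε) ≤ 3` (growth lemma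
  `isBigO_tensorRank_kroneckerPow_of_asymptoticRank_sq_le` + `asymptoticRank_le_of_forall_isBigO`),
  hence `= 3` (`asymptoticRank_leviCivita_eq_three_of_det3`);
* `bThesis_iff_asymptoticRank_cwTensor_le_three` — the growth form `BThesis` is `R̃(T_cw,2) ≤ 3`;
* `bSkewDominatesCw_of_bThesis` — NECESSITY of the new piece: `BThesis → BSkewDominatesCw`
  (`R̃(T_cw,2) ≤ 3 ≤ R̃(ε)`);
* `bThesis_of_skew_subs` — the SPLIT GLUE `BDet3AsymptoticRank → BSkewDominatesCw → BThesis`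
  with the route's decls as hypotheses BY NAME (so that the crux can be split into the two items);
* `bSkewDominatesCw_iff_bThesis_of_det3` — modulo crux 0591 the new piece is EQUIVALENT to the crux:
  `BDet3AsymptoticRank → (BSkewDominatesCw ↔ BThesis)`.

What is NOT here: any proof of `BDet3AsymptoticRank` (open: `9 ≤ R̃(det₃) ≤ 17` is all that is
known, CGLV 2022 §2.3, Conner–Huang–Landsberg 2020 §8) or of `BSkewDominatesCw` (open; all known
universal spectral points equal `3` at both tensors, and no honest degeneration `ε ⊵ T_cw,2`
exists since the `GL₃³`-orbit of `ε` has dimension 17 < 23 = that of `T_cw,2`).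

References: A. Conner, F. Gesmundo, J. M. Landsberg, E. Ventura, comput. complexity 31 (2022) =
arXiv:1909.04785, §2.2–2.3, Lemma 2.4; M. Christandl, P. Vrana, J. Zuiddam, JAMS 36 (2023), §1.1
and Example 1.4 (gauge points).
-/

set_option linter.dupNamespace false

noncomputable section

namespace Summit.MatrixMultiplication.MatrixMultiplication.Theorems

open Module Submodule
open Literature.Computability.AlgebraicComplexity
open Literature.Barriers.MatrixMultiplication (flatteningRank_le_asymptoticRank)
open Summit.MatrixMultiplication.MatrixMultiplication.Theses.AsymptoticRankCW
  (BThesis BDet3AsymptoticRank BSkewDominatesCw)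

/-! ## The Levi-Civita tensor: flattening lower bound and the consequence of crux 0591 -/

section LeviCivita

/-- **`ζ⁽¹⁾(ε) = 3`**: the three `x`-slices of the Levi-Civita tensor are linearly independent
(slice `a` is the only one with a non-zero entry at `(a+1, a+2)`). [folklore] -/
theorem flatteningRank_leviCivita :
    flatteningRank (fun a b c : Fin 3 => (if b = a + 1 ∧ c = a + 2 then (1 : ℂ) else 0) -
      (if b = a + 2 ∧ c = a + 1 then 1 else 0)) = 3 := by
  have hli : LinearIndependent ℂ (xSlices (fun a b c : Fin 3 =>
      (if b = a + 1 ∧ c = a + 2 then (1 : ℂ) else 0) -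
        (if b = a + 2 ∧ c = a + 1 then 1 else 0))) := by
    rw [Fintype.linearIndependent_iff]
    intro g hg a
    have hev : ∀ b c : Fin 3, (∑ i : Fin 3, g i * ((if b = i + 1 ∧ c = i + 2 then (1 : ℂ) else 0) -
        (if b = i + 2 ∧ c = i + 1 then 1 else 0))) = 0 := by
      intro b c
      have := congrFun hg (b, c)
      simpa [Finset.sum_apply, Pi.smul_apply, xSlices_apply, smul_eq_mul] using this
    have h := hev (a + 1) (a + 2)
    fin_cases a <;> simpa [Fin.sum_univ_three] using h
  unfold flatteningRank
  rw [finrank_span_eq_card hli, Fintype.card_fin]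

/-- **`3 ≤ R̃(ε)`**: the flattening rank `ζ⁽¹⁾(ε) = 3` bounds the asymptotic rank of the
Levi-Civita tensor from below (gauge points are spectral points, CVZ 2023 Example 1.4).
[cite: ChristandlVranaZuiddam2023, Example 1.4] -/
theorem three_le_asymptoticRank_leviCivita :
    (3 : ℝ) ≤ asymptoticRank (fun a b c : Fin 3 => (if b = a + 1 ∧ c = a + 2 then (1 : ℂ) else 0) -
      (if b = a + 2 ∧ c = a + 1 then 1 else 0)) := by
  have h := flatteningRank_le_asymptoticRank (fun a b c : Fin 3 =>
    (if b = a + 1 ∧ c = a + 2 then (1 : ℂ) else 0) - (if b = a + 2 ∧ c = a + 1 then 1 else 0))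
  rw [flatteningRank_leviCivita] at h
  exact_mod_cast h

/-- **Crux 0591 pins the skew sibling**: `R̃(ε ⊠ ε) = 9 ⇒ R̃(ε) ≤ 3` — from `R̃(ε ⊠ ε) ≤ 3²` the
Kronecker powers of `ε` grow like `O(3^{(1+δ)N})` (`isBigO_tensorRank_kroneckerPow_of_asymptoticRank_sq_le`),
and the growth form gives the bound on the infimum (`asymptoticRank_le_of_forall_isBigO`).
[cite: ConnerGesmundoLandsbergVentura2022, §2.3] -/
theorem asymptoticRank_leviCivita_le_three_of_det3 (h : BDet3AsymptoticRank) :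
    asymptoticRank (fun a b c : Fin 3 => (if b = a + 1 ∧ c = a + 2 then (1 : ℂ) else 0) -
      (if b = a + 2 ∧ c = a + 1 then 1 else 0)) ≤ 3 := by
  unfold Summit.MatrixMultiplication.MatrixMultiplication.Theses.AsymptoticRankCW.BDet3AsymptoticRank
    at h
  have h9 : asymptoticRank (kroneckerTensor
      (fun a b c : Fin 3 => (if b = a + 1 ∧ c = a + 2 then (1 : ℂ) else 0) -
        (if b = a + 2 ∧ c = a + 1 then 1 else 0))
      (fun a b c : Fin 3 => (if b = a + 1 ∧ c = a + 2 then (1 : ℂ) else 0) -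
        (if b = a + 2 ∧ c = a + 1 then 1 else 0))) ≤ (3 : ℝ) ^ 2 := by
    rw [h]; norm_num
  have hgrowth := isBigO_tensorRank_kroneckerPow_of_asymptoticRank_sq_le _ 3 (by norm_num) h9
  exact asymptoticRank_le_of_forall_isBigO _ (by norm_num) hgrowth

/-- `R̃(ε ⊠ ε) = 9 ⇒ R̃(ε) = 3` (with the flattening lower bound).
[cite: ConnerGesmundoLandsbergVentura2022, §2.3] -/
theorem asymptoticRank_leviCivita_eq_three_of_det3 (h : BDet3AsymptoticRank) :
    asymptoticRank (fun a b c : Fin 3 => (if b = a + 1 ∧ c = a + 2 then (1 : ℂ) else 0) -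
      (if b = a + 2 ∧ c = a + 1 then 1 else 0)) = 3 :=
  le_antisymm (asymptoticRank_leviCivita_le_three_of_det3 h) three_le_asymptoticRank_leviCivita

end LeviCivita

/-! ## The growth form `BThesis` as a bound on `R̃(T_cw,2)` -/

section Thesis

/-- **`BThesis ↔ R̃(T_cw,2) ≤ 3`**: the inline Kronecker power of `BThesis` is
`kroneckerPow (cwTensor ℂ 2) N` by `rfl`, and growth form ↔ infimum bound
(`asymptoticRank_le_of_forall_isBigO`, `isBigO_of_asymptoticRank_le`). [folklore] -/
theorem bThesis_iff_asymptoticRank_cwTensor_le_three :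
    BThesis ↔ asymptoticRank (cwTensor ℂ 2) ≤ 3 := by
  unfold Summit.MatrixMultiplication.MatrixMultiplication.Theses.AsymptoticRankCW.BThesis
  constructor
  · intro hX
    exact asymptoticRank_le_of_forall_isBigO (cwTensor ℂ 2) (by norm_num) hX
  · intro h3 ε hε
    exact isBigO_of_asymptoticRank_le (cwTensor ℂ 2) (by norm_num) h3 hε

/-- **Necessity of the new piece**: `BThesis → BSkewDominatesCw`, since
`R̃(T_cw,2) ≤ 3 ≤ R̃(ε)` (flattening). So `BSkewDominatesCw` (stmt-18009) is implied by the crux it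
serves. [folklore] -/
theorem bSkewDominatesCw_of_bThesis (hX : BThesis) : BSkewDominatesCw := by
  unfold Summit.MatrixMultiplication.MatrixMultiplication.Theses.AsymptoticRankCW.BSkewDominatesCw
  have h3 : asymptoticRank (cwTensor ℂ 2) ≤ 3 := bThesis_iff_asymptoticRank_cwTensor_le_three.1 hX
  exact h3.trans three_le_asymptoticRank_leviCivita

/-- **Split glue** (line `skew_anchor`): `BDet3AsymptoticRank → BSkewDominatesCw → BThesis` —
ARC at the skew sibling (`R̃(ε ⊠ ε) = 9`, hence `R̃(ε) = 3`) plus asymptotic domination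
`R̃(T_cw,2) ≤ R̃(ε)` give `R̃(T_cw,2) ≤ 3`, i.e. the growth form `BThesis`. Hypotheses are the
route's decls by name. [cite: ConnerGesmundoLandsbergVentura2022, §2.2–2.3] -/
theorem bThesis_of_skew_subs (h₁ : BDet3AsymptoticRank) (h₂ : BSkewDominatesCw) : BThesis := by
  unfold Summit.MatrixMultiplication.MatrixMultiplication.Theses.AsymptoticRankCW.BSkewDominatesCw
    at h₂
  exact bThesis_iff_asymptoticRank_cwTensor_le_three.2
    (h₂.trans (asymptoticRank_leviCivita_le_three_of_det3 h₁))

/-- **Modulo crux 0591 the new piece IS the crux**: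
`BDet3AsymptoticRank → (BSkewDominatesCw ↔ BThesis)` (glue one way, necessity the other).
[folklore] -/
theorem bSkewDominatesCw_iff_bThesis_of_det3 (h₁ : BDet3AsymptoticRank) :
    BSkewDominatesCw ↔ BThesis :=
  ⟨bThesis_of_skew_subs h₁, bSkewDominatesCw_of_bThesis⟩

end Thesis

end Summit.MatrixMultiplication.MatrixMultiplication.Theorems

end
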